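import Mathlib
import Summits.CriticalPhenomena.PercolationContinuityZ3.Theorems.PercNonProliferationFreeBoxPowerSavingSizeSplitting
import Summits.CriticalPhenomena.PercolationContinuityZ3.Theorems.PercNonProliferationFreeBoxPowerSavingLogBoost
import Summits.CriticalPhenomena.PercolationContinuityZ3.Theorems.FreeBoxPowerSaving.Negative.FreeBoxPowerSavingStubGuards

/-!
# Crux `PercNonProliferation.FreeBoxPowerSaving` (stmt-CriticalPhenomena-4447), line
# `boundary-interior-split-fat-finite-clusters` — multiple size splitting and the sharp shattering boost

Helper file of the lead (prover-line-stmt-CriticalPhenomena-4447-1, gen 1); lands with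
`--supports stmt-CriticalPhenomena-4447` (registered sub-goal
`quasiGiantNotAS_of_polyRareShattering_sharp`).  It sharpens the shattering boost of
`Theorems/PercNonProliferationFreeBoxPowerSavingShatteringBoost.lean` (p96610) from the exponent
condition `b log 3 < a log 2` to the natural `b < a`, by replacing the two-fold size splitting
(`q(3s) ≤ q(s)²`, Hutchcroft 2021 Thm 2.3 with `k = 1`) with the general MULTIPLE splitting
`q((2j+1)s) ≤ q(s)^{j+1}` (Hutchcroft 2021, Lemma 2.4 / Thm 2.3 in vertex form, any `j`).

Notation: `q_p(n,t) = P_p(QG(n,t))`, `QG(n,t)` = "some vertex of the free box `B(n) = box 3 n`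
is joined inside `B(n)` to at least `t` vertices of `B(n)`" (bond percolation `P_p` on `ℤ³`).
* `MultiSplit.exists_multi_split` (pure graph theory, any simple graph): a finite vertex set `P`
  connected through itself from `r ∈ P` with `|P| + 2j ≥ (2j+1) m`, `m ≥ 1`, contains `j+1` subsets,
  each connected through itself from a base point and of size `≥ m`, pairwise meeting in at most one
  vertex — iterate the landed rooted splitting `exists_rooted_split` (p77722): peel `Q` with
  `m ≤ |Q| ≤ 2m-1`, keep `insert q (P \ Q)`, repeat.
* `MultiSplit.largePiece_subset_disjointOccurrenceList`: for real `s ≥ 1`, the event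
  `QG(B, (2j+1)s)` lies in the `(j+1)`-fold disjoint occurrence of `QG(B, s)` (witnesses: the open
  non-loop pairs inside each subset; pairwise disjoint because the subsets pairwise share `≤ 1` vertex).
* `MultiSplit.real_largePiece_le_pow`: by the van den Berg–Kesten–Reimer chain `bk_finitary_list`,
  `P_p(QG(B, (2j+1)s)) ≤ P_p(QG(B, s))^{j+1}` — any countable graph, any finite `B`, any `p`.
* `MultiSplit.one_sub_le_log_div` (THE SHARP BOOST, every `p`): for real `s ≥ 1`, if
  `q_p(n,(2j+1)s) > 0` then `1 - q_p(n,s) ≤ log(1/q_p(n,(2j+1)s)) / (j+1)`.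
* `quasiGiantNotAS_of_polyRareShattering_sharp` (registered form, every `p`): if for some
  `0 < b < a` eventually `n^{-b} ≤ P_p(no piece of B(n) has ≥ n^{3-a} vertices)`, then with
  `a' = (a-b)/2` eventually `q_p(n, n^{3-a'}) ≤ 1/2` (the one-bit hypothesis of `stub_logBoost`);
  `MultiSplit.freeBoxPowerSaving_of_polyRareShattering_sharp`: at `p_c` this proves the crux.
  So, modulo landed theorems: crux ⟺ QG-NAS ⟺ "∃ a > b > 0: eventually
  P_{p_c}(all free-box pieces of Λ_n have < n^{3-a} vertices) ≥ n^{-b}". -/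

noncomputable section

open MeasureTheory Filter Topology
open scoped Classical
open Literature.Probability.Percolation Literature.Probability.LatticeModels

namespace Summit.CriticalPhenomena.PercolationContinuityZ3.FreeBoxPowerSavingLine

namespace MultiSplit

/-! ### §1 Iterated splitting of a connected finite vertex set -/

section Splitting

variable {V : Type*} {H : SimpleGraph V}

/-- **Multiple splitting** (Hutchcroft 2021, Lemma 2.4, iterated): a finite set `P` connected
through itself from `r ∈ P`, with `(2j+1) m ≤ |P| + 2j` and `m ≥ 1`, contains a list of `j+1`
subsets, each `⊆ P`, each connected through itself from one of its vertices and of size `≥ m`, any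
two of which share at most one vertex. [cite: Hutchcroft2021, Lemma 2.4] -/
theorem exists_multi_split (j : ℕ) :
    ∀ (P : Finset V) (r : V) (m : ℕ), r ∈ P → (∀ a ∈ P, PathIn H ↑P r a) → 1 ≤ m →
      (2 * j + 1) * m ≤ P.card + 2 * j →
      ∃ L : List (Finset V), L.length = j + 1 ∧
        (∀ Q ∈ L, Q ⊆ P ∧ ∃ q ∈ Q, (∀ a ∈ Q, PathIn H ↑Q q a) ∧ m ≤ Q.card) ∧
        L.Pairwise fun Q Q' => (Q ∩ Q').card ≤ 1 := by
  induction j with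
  | zero =>
    intro P r m hr hP _ hmP
    refine ⟨[P], rfl, fun Q hQ => ?_, List.pairwise_singleton _ _⟩
    obtain rfl : Q = P := by simpa using hQ
    exact ⟨Finset.Subset.rfl, r, hr, hP, by omega⟩
  | succ j ih =>
    intro P r m hr hP hm hmP
    have hmP' : m ≤ P.card := by nlinarith
    obtain ⟨Q, hQP, q, hqQ, hQconn, hmQ, hQm, hrest⟩ := exists_rooted_split P r m hr hP hm hmP'
    set R : Finset V := insert q (P \ Q) with hR
    have hrR : r ∈ R := (hrest q (Finset.mem_insert_self _ _)).left_mem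
    have hRcard : R.card = P.card - Q.card + 1 := by
      rw [hR, Finset.card_insert_of_notMem (fun h => (Finset.mem_sdiff.1 h).2 hqQ),
        Finset.card_sdiff_of_subset hQP]
    have hQP' : Q.card ≤ P.card := Finset.card_le_card hQP
    have hRbig : (2 * j + 1) * m ≤ R.card + 2 * j := by
      rw [hRcard]
      have h1 : (2 * (j + 1) + 1) * m = (2 * j + 1) * m + 2 * m := by ring
      omega
    obtain ⟨L, hLlen, hLmem, hLpw⟩ := ih R r m hrR hrest hm hRbig
    have hRP : R ⊆ P := Finset.insert_subset (hQP hqQ) Finset.sdiff_subset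
    refine ⟨Q :: L, by simp [hLlen], ?_, ?_⟩
    · intro Q' hQ'
      rcases List.mem_cons.1 hQ' with rfl | hQ'L
      · exact ⟨hQP, q, hqQ, hQconn, hmQ⟩
      · obtain ⟨hQ'R, hq'⟩ := hLmem Q' hQ'L
        exact ⟨hQ'R.trans hRP, hq'⟩
    · refine List.pairwise_cons.2 ⟨fun Q' hQ'L => ?_, hLpw⟩
      have hQ'R : Q' ⊆ R := (hLmem Q' hQ'L).1
      have key : ∀ c ∈ Q ∩ Q', c = q := fun c hc => by
        rw [Finset.mem_inter] at hc
        have hcR := hQ'R hc.2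
        rw [hR, Finset.mem_insert, Finset.mem_sdiff] at hcR
        exact hcR.elim id fun h => absurd hc.1 h.2
      exact Finset.card_le_one.2 fun a ha b hb => by rw [key a ha, key b hb]

end Splitting

/-! ### §2 Multiple size splitting of the largest piece under bond percolation -/

section Percolation

variable {V : Type*}

/-- **Deterministic multiple size splitting**: for real `s ≥ 1` and any `j`, if some vertex of `B`
is joined inside `B` to `≥ (2j+1) s` vertices, then the event "some vertex of `B` is joined inside
`B` to `≥ s` vertices" occurs disjointly `j+1` times. [cite: Hutchcroft2021, Thm 2.3] -/
theorem largePiece_subset_disjointOccurrenceList (B : Finset V) {s : ℝ} (hs : 1 ≤ s) (j : ℕ) :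
    {ω : BondConfig V | ∃ u ∈ B,
        (2 * j + 1) * s ≤ ((B.filter fun v => ω ∈ openConnIn ↑B u v).card : ℝ)} ⊆
      disjointOccurrenceList (List.replicate (j + 1)
        {ω : BondConfig V | ∃ u ∈ B, s ≤ ((B.filter fun v => ω ∈ openConnIn ↑B u v).card : ℝ)}) := by
  rintro ω ⟨u, hu, hjs⟩
  obtain ⟨P, hP⟩ : ∃ P : Finset V, P = B.filter fun v => ω ∈ openConnIn ↑B u v := ⟨_, rfl⟩
  rw [← hP] at hjs
  -- integer threshold `m = ⌈s⌉`
  have hm1 : 1 ≤ ⌈s⌉₊ := Nat.one_le_ceil_iff.2 (by linarith)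
  have hsm : s ≤ (⌈s⌉₊ : ℝ) := Nat.le_ceil s
  have hcard : (2 * j + 1) * ⌈s⌉₊ ≤ P.card + 2 * j := by
    have hlt : (⌈s⌉₊ : ℝ) < s + 1 := Nat.ceil_lt_add_one (by linarith)
    have hj0 : (0 : ℝ) ≤ 2 * j + 1 := by positivity
    have h3 : ((2 * j + 1) * ⌈s⌉₊ : ℝ) < P.card + 2 * j + 1 := by
      calc ((2 * j + 1) * ⌈s⌉₊ : ℝ) < (2 * j + 1) * (s + 1) :=
            mul_lt_mul_of_pos_left hlt (by positivity)
        _ = (2 * j + 1) * s + (2 * j + 1) := by ring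
        _ ≤ P.card + (2 * j + 1) := by linarith
        _ = P.card + 2 * j + 1 := by ring
    have h4 : ((2 * j + 1) * ⌈s⌉₊ : ℕ) < P.card + 2 * j + 1 := by exact_mod_cast h3
    omega
  -- the piece `P` of `u` is connected through itself from `u` in the open graph
  have hmem : ∀ {v}, v ∈ P ↔ PathIn (openGraph ω) ↑B u v := fun {v} => by
    rw [hP, Finset.mem_filter, DCT16.mem_openConnIn_iff_pathIn, and_iff_right_iff_imp]
    exact fun h => h.right_mem
  have hPB : P ⊆ B := fun v hv => (hmem.1 hv).right_mem
  have hconn : ∀ a ∈ P, PathIn (openGraph ω) ↑P u a := fun a ha =>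
    (pathIn_restrict (hmem.1 ha)).mono fun w hw => Finset.mem_coe.2 (hmem.2 hw.2)
  obtain ⟨L, hLlen, hLmem, hLpw⟩ :=
    exists_multi_split j P u ⌈s⌉₊ (hmem.2 (PathIn.refl (Finset.mem_coe.2 hu))) hconn hm1 hcard
  -- witnesses: open non-loop pairs with both ends in `Q`, for `Q ∈ L`
  set A : Set (BondConfig V) :=
    {ω : BondConfig V | ∃ u ∈ B, s ≤ ((B.filter fun v => ω ∈ openConnIn ↑B u v).card : ℝ)} with hA
  set wit : Finset V → Set (Sym2 V) := fun Q => {e | e ∈ ω ∧ ¬ e.IsDiag ∧ ∀ a ∈ e, a ∈ Q} with hwit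
  have hmapfst : (L.map fun Q => (A, wit Q)).map Prod.fst = List.replicate (j + 1) A := by
    rw [List.map_map, ← hLlen]
    exact List.eq_replicate_iff.2 ⟨by simp, fun b hb => by
      obtain ⟨Q, _, rfl⟩ := List.mem_map.1 hb; rfl⟩
  rw [← hmapfst]
  refine mem_disjointOccurrenceList_of_pairwise_disjoint (L.map fun Q => (A, wit Q)) ?_ ?_ ?_ ?_
  · intro p hp
    obtain ⟨Q, _, rfl⟩ := List.mem_map.1 hp
    exact isUpperSet_largePiece B s
  · intro p hp
    obtain ⟨Q, hQ, rfl⟩ := List.mem_map.1 hp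
    obtain ⟨hQP, q, hqQ, hQconn, hmQ⟩ := hLmem Q hQ
    exact witness_mem_largePiece (hQP.trans hPB) hqQ hQconn (hsm.trans (by exact_mod_cast hmQ))
  · rw [List.pairwise_map]
    exact hLpw.imp fun {Q Q'} h => disjoint_witnesses h ω
  · intro p hp
    obtain ⟨Q, _, rfl⟩ := List.mem_map.1 hp
    exact fun e he => he.1

/-- **Multiple size splitting under `P_p`** (Hutchcroft 2021, Thm 2.3 in vertex form, for the finite
graph induced on `B`; van den Berg–Kesten): for Bernoulli bond percolation on any graph with
countably many vertices, any finite vertex set `B`, any real `s ≥ 1` and any `j`,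
`P_p(∃ u ∈ B, |piece of u in B| ≥ (2j+1)s) ≤ P_p(∃ u ∈ B, |piece of u in B| ≥ s)^{j+1}`.
[cite: Hutchcroft2021, Thm 2.3] -/
theorem real_largePiece_le_pow [Countable V] (G : SimpleGraph V) (p : unitInterval)
    (B : Finset V) {s : ℝ} (hs : 1 ≤ s) (j : ℕ) :
    (bondPercolation G p).real
        {ω : BondConfig V | ∃ u ∈ B,
          (2 * j + 1) * s ≤ ((B.filter fun v => ω ∈ openConnIn ↑B u v).card : ℝ)}
      ≤ ((bondPercolation G p).real
        {ω : BondConfig V | ∃ u ∈ B,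
          s ≤ ((B.filter fun v => ω ∈ openConnIn ↑B u v).card : ℝ)}) ^ (j + 1) := by
  refine (measureReal_mono (largePiece_subset_disjointOccurrenceList B hs j)).trans ?_
  refine (bk_finitary_list G p _ (fun A hA => ?_) (fun A hA => ?_)).trans_eq ?_
  · rw [List.eq_of_mem_replicate hA]; exact isUpperSet_largePiece B s
  · rw [List.eq_of_mem_replicate hA]; exact isFinitary_largePiece B s
  · rw [List.map_replicate, List.prod_replicate]

end Percolation

/-! ### §3 The sharp shattering boost on the free box of `ℤ³` -/

/-- **Multiple size splitting on the free box**: `q_p(n,(2j+1)s) ≤ q_p(n,s)^{j+1}` (`s ≥ 1`). -/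
theorem q_mul_le_pow (p : unitInterval) (n : ℕ) {s : ℝ} (hs : 1 ≤ s) (j : ℕ) :
    (bondPercolation (zdGraph 3) p).real
        {ω | ∃ u ∈ box 3 n, ((2 * j + 1) * s : ℝ) ≤
          (((box 3 n).filter fun v => ω ∈ openConnIn ↑(box 3 n) u v).card : ℝ)}
      ≤ ((bondPercolation (zdGraph 3) p).real
        {ω | ∃ u ∈ box 3 n, (s : ℝ) ≤
          (((box 3 n).filter fun v => ω ∈ openConnIn ↑(box 3 n) u v).card : ℝ)}) ^ (j + 1) :=
  real_largePiece_le_pow (zdGraph 3) p (box 3 n) hs j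

/-- **The sharp shattering boost** (every `p`): for real `s ≥ 1` and any `j`, if fat pieces at the
threshold `(2j+1) s` have positive probability then `1 - q(s) ≤ log(1/q((2j+1)s)) / (j+1)`. -/
theorem one_sub_le_log_div (p : unitInterval) (n : ℕ) {s : ℝ} (hs : 1 ≤ s) (j : ℕ)
    (hpos : 0 < (bondPercolation (zdGraph 3) p).real
        {ω | ∃ u ∈ box 3 n, ((2 * j + 1) * s : ℝ) ≤
          (((box 3 n).filter fun v => ω ∈ openConnIn ↑(box 3 n) u v).card : ℝ)}) :
    1 - (bondPercolation (zdGraph 3) p).real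
        {ω | ∃ u ∈ box 3 n, (s : ℝ) ≤
          (((box 3 n).filter fun v => ω ∈ openConnIn ↑(box 3 n) u v).card : ℝ)}
      ≤ Real.log ((bondPercolation (zdGraph 3) p).real
        {ω | ∃ u ∈ box 3 n, ((2 * j + 1) * s : ℝ) ≤
          (((box 3 n).filter fun v => ω ∈ openConnIn ↑(box 3 n) u v).card : ℝ)})⁻¹ / (j + 1) := by
  have hiter := q_mul_le_pow p n hs j
  set x : ℝ := (bondPercolation (zdGraph 3) p).real
        {ω | ∃ u ∈ box 3 n, (s : ℝ) ≤
          (((box 3 n).filter fun v => ω ∈ openConnIn ↑(box 3 n) u v).card : ℝ)} with hx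
  set y : ℝ := (bondPercolation (zdGraph 3) p).real
        {ω | ∃ u ∈ box 3 n, ((2 * j + 1) * s : ℝ) ≤
          (((box 3 n).filter fun v => ω ∈ openConnIn ↑(box 3 n) u v).card : ℝ)} with hy
  have hx0 : 0 ≤ x := measureReal_nonneg
  have hxpos : 0 < x := by
    by_contra hle
    have hx0' : x = 0 := le_antisymm (not_lt.1 hle) hx0
    have : y ≤ 0 := hiter.trans_eq (by rw [hx0']; exact zero_pow (Nat.succ_ne_zero j))
    exact absurd hpos (not_lt.2 this)
  have hj : (0 : ℝ) < j + 1 := by positivity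
  have hlog : Real.log y ≤ ((j + 1 : ℕ) : ℝ) * Real.log x := by
    calc Real.log y ≤ Real.log (x ^ (j + 1)) := Real.log_le_log hpos hiter
      _ = ((j + 1 : ℕ) : ℝ) * Real.log x := Real.log_pow _ _
  have h1x : 1 - x ≤ -Real.log x := by
    have := Real.log_le_sub_one_of_pos hxpos
    linarith
  rw [Real.log_inv, le_div_iff₀ hj]
  push_cast at hlog
  calc (1 - x) * (j + 1) ≤ -Real.log x * (j + 1) := by gcongr
    _ = -((j + 1 : ℝ) * Real.log x) := by ring
    _ ≤ -Real.log y := by linarith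

/-- `q(t) = 1` for `t ≤ 1` (every vertex is its own piece). -/
theorem q_eq_one_of_le_one (p : unitInterval) (n : ℕ) {t : ℝ} (ht : t ≤ 1) :
    (bondPercolation (zdGraph 3) p).real
        {ω | ∃ u ∈ box 3 n, (t : ℝ) ≤
          (((box 3 n).filter fun v => ω ∈ openConnIn ↑(box 3 n) u v).card : ℝ)} = 1 := by
  rw [FreeBoxPowerSavingNegative.exists_piece_ge_eq_univ_of_le_one n ht, probReal_univ]

/-- **Polynomially-rare shattering suffices, sharp exponents** (every `p`; proof of the registered
form below).  If `0 < b < a` and eventually `n^{-b} ≤ 1 - q_p(n, n^{3-a})`, then with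
`a' = (a-b)/2` eventually `q_p(n, n^{3-a'}) ≤ 1/2`: otherwise `q((2j+1) n^{3-a}) > 1/2` for the
largest `j` with `2j+1 ≤ n^{a-a'}` (antitonicity), and the sharp boost gives
`1 - q(n^{3-a}) ≤ log 2/(j+1) ≤ 2 log 2 · n^{-(a-a')} < n^{-b}` eventually, as `a - a' = (a+b)/2 > b`. -/
theorem quasiGiantNotAS_of_polyRareShattering_sharp_at (p : unitInterval) {a b : ℝ} (hb : 0 < b)
    (hab : b < a)
    (h : ∀ᶠ n : ℕ in atTop, (n : ℝ) ^ (-b) ≤ 1 - (bondPercolation (zdGraph 3) p).real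
        {ω | ∃ u ∈ box 3 n, ((n : ℝ) ^ (3 - a) : ℝ) ≤
          (((box 3 n).filter fun v => ω ∈ openConnIn ↑(box 3 n) u v).card : ℝ)}) :
    ∃ a' ε : ℝ, 0 < a' ∧ 0 < ε ∧ ∀ᶠ n : ℕ in atTop,
      (bondPercolation (zdGraph 3) p).real
          {ω | ∃ u ∈ box 3 n, ((n : ℝ) ^ (3 - a') : ℝ) ≤
            (((box 3 n).filter fun v => ω ∈ openConnIn ↑(box 3 n) u v).card : ℝ)} ≤ 1 - ε := by
  set a' : ℝ := (a - b) / 2 with ha'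
  have ha'0 : 0 < a' := by rw [ha']; linarith
  set g : ℝ := a - a' with hg
  have hg0 : 0 < g := by rw [hg, ha']; linarith
  have hgb : b < g := by rw [hg, ha']; linarith
  refine ⟨a', 1 / 2, ha'0, by norm_num, ?_⟩
  -- eventually `3 log 2 · n^{-g} < n^{-b}`
  have hsmall : ∀ᶠ n : ℕ in atTop, 3 * Real.log 2 * (n : ℝ) ^ (-g) < (n : ℝ) ^ (-b) := by
    have hlim : Tendsto (fun n : ℕ => 3 * Real.log 2 * (n : ℝ) ^ (-(g - b))) atTop (𝓝 0) := by
      have h := ((tendsto_rpow_neg_atTop (by linarith : 0 < g - b)).comp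
        tendsto_natCast_atTop_atTop).const_mul (3 * Real.log 2)
      simpa using h
    filter_upwards [hlim.eventually (gt_mem_nhds (by norm_num : (0 : ℝ) < 1)),
      eventually_ge_atTop 1] with n hn hn1
    have hn0 : (0 : ℝ) < n := by exact_mod_cast hn1
    have hsplit : (n : ℝ) ^ (-g) = (n : ℝ) ^ (-(g - b)) * (n : ℝ) ^ (-b) := by
      rw [← Real.rpow_add hn0]; congr 1; ring
    have hbpos : (0 : ℝ) < (n : ℝ) ^ (-b) := Real.rpow_pos_of_pos hn0 _
    rw [hsplit, ← mul_assoc]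
    calc 3 * Real.log 2 * (n : ℝ) ^ (-(g - b)) * (n : ℝ) ^ (-b)
        < 1 * (n : ℝ) ^ (-b) := mul_lt_mul_of_pos_right hn hbpos
      _ = (n : ℝ) ^ (-b) := one_mul _
  filter_upwards [h, hsmall, eventually_ge_atTop 1] with n hn hsm hn1
  have hn0 : (0 : ℝ) < n := by exact_mod_cast hn1
  have hn1' : (1 : ℝ) ≤ n := by exact_mod_cast hn1
  set s : ℝ := (n : ℝ) ^ (3 - a) with hs
  have hs1 : 1 ≤ s := by
    by_contra hlt
    push Not at hlt
    have hq1 := q_eq_one_of_le_one p n hlt.le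
    have : (0 : ℝ) < (n : ℝ) ^ (-b) := Real.rpow_pos_of_pos hn0 _
    rw [hq1] at hn
    linarith
  by_contra hcon
  push Not at hcon
  have hbig : 1 / 2 < (bondPercolation (zdGraph 3) p).real
      {ω | ∃ u ∈ box 3 n, ((n : ℝ) ^ (3 - a') : ℝ) ≤
        (((box 3 n).filter fun v => ω ∈ openConnIn ↑(box 3 n) u v).card : ℝ)} := by linarith
  -- the number of splittings: `j = ⌊(n^g - 1)/2⌋₊`, so `2j+1 ≤ n^g < 2j+3`
  set j : ℕ := ⌊((n : ℝ) ^ g - 1) / 2⌋₊ with hj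
  have hng1 : (1 : ℝ) ≤ (n : ℝ) ^ g := Real.one_le_rpow hn1' hg0.le
  have hL0 : 0 ≤ ((n : ℝ) ^ g - 1) / 2 := by linarith
  have hjle : (j : ℝ) ≤ ((n : ℝ) ^ g - 1) / 2 := Nat.floor_le hL0
  have hjlt : ((n : ℝ) ^ g - 1) / 2 < j + 1 := Nat.lt_floor_add_one _
  have h2j1 : (2 * j + 1 : ℝ) ≤ (n : ℝ) ^ g := by linarith
  have hjinv : 1 / ((j : ℝ) + 1) ≤ 3 * (n : ℝ) ^ (-g) := by
    rw [Real.rpow_neg hn0.le, div_le_iff₀ (by positivity : (0 : ℝ) < j + 1)]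
    have hngpos : (0 : ℝ) < (n : ℝ) ^ g := by positivity
    have h3j : (n : ℝ) ^ g ≤ 3 * ((j : ℝ) + 1) := by linarith
    calc (1 : ℝ) = ((n : ℝ) ^ g)⁻¹ * (n : ℝ) ^ g := (inv_mul_cancel₀ hngpos.ne').symm
      _ ≤ ((n : ℝ) ^ g)⁻¹ * (3 * ((j : ℝ) + 1)) := by gcongr
      _ = 3 * ((n : ℝ) ^ g)⁻¹ * ((j : ℝ) + 1) := by ring
  -- `(2j+1) s ≤ n^{3-a'}`
  have hthr : (2 * j + 1 : ℝ) * s ≤ (n : ℝ) ^ (3 - a') := by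
    calc (2 * j + 1 : ℝ) * s ≤ (n : ℝ) ^ g * s := by
          have : (0 : ℝ) ≤ s := by linarith
          gcongr
      _ = (n : ℝ) ^ (g + (3 - a)) := by rw [hs, ← Real.rpow_add hn0]
      _ = (n : ℝ) ^ (3 - a') := by congr 1; rw [hg]; ring
  have hpos : 1 / 2 < (bondPercolation (zdGraph 3) p).real
      {ω | ∃ u ∈ box 3 n, ((2 * j + 1) * s : ℝ) ≤
        (((box 3 n).filter fun v => ω ∈ openConnIn ↑(box 3 n) u v).card : ℝ)} :=
    hbig.trans_le (measureReal_mono (fun ω ⟨u, hu, h'⟩ => ⟨u, hu, hthr.trans h'⟩)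
      (measure_ne_top _ _))
  have hpos0 : 0 < (bondPercolation (zdGraph 3) p).real
      {ω | ∃ u ∈ box 3 n, ((2 * j + 1) * s : ℝ) ≤
        (((box 3 n).filter fun v => ω ∈ openConnIn ↑(box 3 n) u v).card : ℝ)} := by linarith
  have hboost := one_sub_le_log_div p n hs1 j hpos0
  have hlogq : Real.log ((bondPercolation (zdGraph 3) p).real
      {ω | ∃ u ∈ box 3 n, ((2 * j + 1) * s : ℝ) ≤
        (((box 3 n).filter fun v => ω ∈ openConnIn ↑(box 3 n) u v).card : ℝ)})⁻¹ ≤ Real.log 2 := by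
    apply Real.log_le_log (inv_pos.2 hpos0)
    rw [inv_le_comm₀ hpos0 (by norm_num)]
    linarith
  have hlog2 : 0 < Real.log 2 := Real.log_pos (by norm_num)
  have hchain : 1 - (bondPercolation (zdGraph 3) p).real
      {ω | ∃ u ∈ box 3 n, (s : ℝ) ≤
        (((box 3 n).filter fun v => ω ∈ openConnIn ↑(box 3 n) u v).card : ℝ)}
      ≤ 3 * Real.log 2 * (n : ℝ) ^ (-g) := by
    calc _ ≤ Real.log ((bondPercolation (zdGraph 3) p).real
          {ω | ∃ u ∈ box 3 n, ((2 * j + 1) * s : ℝ) ≤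
            (((box 3 n).filter fun v => ω ∈ openConnIn ↑(box 3 n) u v).card : ℝ)})⁻¹ / (j + 1) :=
          hboost
      _ ≤ Real.log 2 / (j + 1) := by gcongr
      _ = Real.log 2 * (1 / ((j : ℝ) + 1)) := by ring
      _ ≤ Real.log 2 * (3 * (n : ℝ) ^ (-g)) := by gcongr
      _ = 3 * Real.log 2 * (n : ℝ) ^ (-g) := by ring
  have : 1 - (bondPercolation (zdGraph 3) p).real
      {ω | ∃ u ∈ box 3 n, (s : ℝ) ≤
        (((box 3 n).filter fun v => ω ∈ openConnIn ↑(box 3 n) u v).card : ℝ)} < (n : ℝ) ^ (-b) :=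
    hchain.trans_lt hsm
  linarith

end MultiSplit

/-- **Polynomially-rare shattering suffices, sharp exponents — registered form** (sub-goal of
stmt-CriticalPhenomena-4447, all binders explicit; every `p`): if for some `0 < b < a` eventually
`n^{-b} ≤ P_p(no piece of B(n) has ≥ n^{3-a} vertices)`, then for some `a', ε > 0` eventually
`P_p(some piece of B(n) has ≥ n^{3-a'} vertices) ≤ 1 - ε` (the one-bit hypothesis of `stub_logBoost`,
verbatim). -/
theorem quasiGiantNotAS_of_polyRareShattering_sharp :
    ∀ (p : unitInterval) (a b : ℝ), 0 < b → b < a →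
      (∀ᶠ n : ℕ in atTop, (n : ℝ) ^ (-b) ≤ 1 - (bondPercolation (zdGraph 3) p).real
          {ω | ∃ u ∈ box 3 n, ((n : ℝ) ^ (3 - a) : ℝ) ≤
            (((box 3 n).filter fun v => ω ∈ openConnIn ↑(box 3 n) u v).card : ℝ)}) →
      ∃ a' ε : ℝ, 0 < a' ∧ 0 < ε ∧ ∀ᶠ n : ℕ in atTop,
        (bondPercolation (zdGraph 3) p).real
            {ω | ∃ u ∈ box 3 n, ((n : ℝ) ^ (3 - a') : ℝ) ≤
              (((box 3 n).filter fun v => ω ∈ openConnIn ↑(box 3 n) u v).card : ℝ)} ≤ 1 - ε :=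
  fun p _ _ hb hab h => MultiSplit.quasiGiantNotAS_of_polyRareShattering_sharp_at p hb hab h

namespace MultiSplit

/-- **Polynomially-rare shattering at `p_c` proves the crux, sharp exponents.**  If for some
`0 < b < a` eventually `P_{p_c}(no free-box piece of Λ_n has ≥ n^{3-a} vertices) ≥ n^{-b}`, then
`FreeBoxPowerSaving` holds (compose with the landed `stub_logBoost`, `stub_sizeSplitting`, and
`FreeBoxPowerSavingNegative.of_eventually`). -/
theorem freeBoxPowerSaving_of_polyRareShattering_sharp {a b : ℝ} (hb : 0 < b) (hab : b < a)
    (h : ∀ᶠ n : ℕ in atTop, (n : ℝ) ^ (-b) ≤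
      1 - (bondPercolation (zdGraph 3) (criticalProbI 3)).real
          {ω | ∃ u ∈ box 3 n, ((n : ℝ) ^ (3 - a) : ℝ) ≤
            (((box 3 n).filter fun v => ω ∈ openConnIn ↑(box 3 n) u v).card : ℝ)}) :
    Summit.CriticalPhenomena.PercolationContinuityZ3.Theses.PercNonProliferation.FreeBoxPowerSaving := by
  obtain ⟨a', ε, ha', hε, hev⟩ := quasiGiantNotAS_of_polyRareShattering_sharp_at (criticalProbI 3) hb hab h
  obtain ⟨a'', C, ha'', hev'⟩ :=
    stub_logBoost (criticalProbI 3) (stub_sizeSplitting (criticalProbI 3)) a' ε ha' hε hev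
  obtain ⟨C', hC'⟩ := FreeBoxPowerSavingNegative.of_eventually ha'' hev'
  exact ⟨a'', C', ha'', fun n hn => hC' n hn⟩

end MultiSplit

end Summit.CriticalPhenomena.PercolationContinuityZ3.FreeBoxPowerSavingLine

end
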